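import Literature.AlgebraicGeometry.HodgeTheory.LefschetzMonodromy
import Literature.AlgebraicGeometry.FundamentalGroup.HypersurfaceComplementZariskiPencils
import Literature.AlgebraicGeometry.FundamentalGroup.HypersurfaceComplementPencilDiscriminantHomogeneous
import HarnessLib

/-!
# Zariski's theorem on the fundamental group of the complement of a projective hypersurface —
# discharge of the named fact `zariski_pi1_lineCompl_surjective` (Voisin II, Thm. 3.22)

Family `hodge`, layer `Literature/AlgebraicGeometry/HodgeTheory`; theorems only. Written by the prover seat
`hodge-nonav-prover-Ax` (g14), programme ZARISKI. The named fact `zariski_pi1_lineCompl_surjective` of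
`HodgeTheory/LefschetzMonodromy` (Voisin, *Hodge Theory II*, Thm. 3.22: for a hypersurface `𝒴 = V(F) ⊂ ℙʳ`,
`U = ℙʳ − 𝒴`, `0 ∈ U` and a projective line `Δ ∋ 0` meeting `𝒴` transversally in its smooth locus, every loop
of `U` at `0` is homotopic to a loop in `Δ`) is PROVED (`zariski_pi1_lineCompl_surjective_holds`), from the
tree's AFFINE Zariski theorem (`HypersurfaceComplementZariskiPencils.exists_loop_in_line_of_pencilDiscr`,
Dimca Ch. 4 Prop. (3.1)) applied to the CONE `ℂ^{r+1} ∖ V(F)` over `U`: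

1. (§1) paths of `ℙʳ(ℂ)` lift to `ℂ^{r+1} ∖ 0` along `v ↦ [v]` (`exists_path_lift_mk`): the standard affine
   charts `{xᵢ ≠ 0}` carry the continuous sections `[x] ↦ x / xᵢ` (`ProjectiveSpace.stdChartFun`), and a path is
   lifted piece by piece over a subdivision subordinate to the charts (Lebesgue number), rescaling each piece to
   match the previous one — the argument of path lifting for covering maps with sections in place of
   trivialisations; a lifted LOOP is closed up by an arc of its fibre `ℂˣ · e`, over which `[·]` is constant
   (`exists_loop_lift_of_saturated`);
2. (§3) for `0 = [e]`, `Δ = ℙ(P)`, a direction `v ∈ P` with `F(v) ≠ 0` exists and the transversality of `Δ` gives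
   `pencilDiscr F (e, v) ≠ 0` on the cone (`HypersurfaceComplementPencilDiscriminantHomogeneous`), so the lifted
   loop is homotopic in the cone to a loop in the affine line `e + ℂ v ⊂ P`;
3. project back to `U` by `v ↦ [v]` (continuous for the quotient topology, §2): the image loop lies in `ℙ(P)`.

The topology on `ℙ ℂ ℂ^{r+1}` is the quotient topology of `Literature/NumberTheory/Transcendental/ProjectiveSpace`
(the one of the named fact).

## References

* [VoisinHodgeII2003] C. Voisin, *Hodge Theory and Complex Algebraic Geometry II*, CUP 2003, §3.2.2 Thm. 3.22.
* [Dimca1992] A. Dimca, *Singularities and Topology of Hypersurfaces* (1992), Ch. 4 §3 Prop. (3.1), §1 (1.13).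
* [HatcherAT2002] A. Hatcher, *Algebraic Topology* (2002), §1.3 Prop. 1.30 (path lifting), §1.1.
-/

noncomputable section

namespace Literature.AlgebraicGeometry.HodgeTheory

open Set unitInterval MvPolynomial
open _root_.Topology
open scoped LinearAlgebra.Projectivization
open Literature.AlgebraicTopology.FundamentalGroup
open Literature.AlgebraicGeometry.FundamentalGroup

section Zariski

variable {n : ℕ}

/-! ### §1 Lifting paths of `ℙⁿ(ℂ)` to `ℂ^{n+1} ∖ 0` -/

/-- The standard affine chart `{xᵢ ≠ 0}` of `ℙⁿ(ℂ)` carries a continuous section `[x] ↦ x / xᵢ` of `v ↦ [v]`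
(the inverse chart composed with the chart). [cite: HatcherAT2002, §1.3 (local sections of a projection)] -/
theorem exists_continuousOn_section_stdChart (i : Fin (n + 1)) :
    ∃ sec : ℙ ℂ (Fin (n + 1) → ℂ) → (Fin (n + 1) → ℂ),
      ContinuousOn sec (Projectivization.stdChartSource i) ∧
        ∃ hsec : ∀ p, sec p ≠ 0, ∀ p ∈ Projectivization.stdChartSource i,
          Projectivization.mk ℂ (sec p) (hsec p) = p := by
  refine ⟨fun p => Fin.insertNth i (1 : ℂ) (Projectivization.stdChartFun i p), ?_,
    fun p => Projectivization.insertNth_one_ne_zero i _, fun p hp => ?_⟩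
  · have h : Continuous fun w : Fin n → ℂ => (Fin.insertNth i (1 : ℂ) w : Fin (n + 1) → ℂ) :=
      Continuous.finInsertNth (A := fun _ ↦ ℂ) i (continuous_const (y := (1 : ℂ))) continuous_id
    exact h.comp_continuousOn (Projectivization.continuousOn_stdChartFun i)
  · exact Projectivization.stdChartInv_stdChartFun i hp

/-- **Path lifting for `ℂ^{n+1} ∖ 0 → ℙⁿ(ℂ)`.** Every path `γ` of `ℙⁿ(ℂ)` and every vector `e ≠ 0` over
`γ(0)` admit a continuous nowhere-zero lift `Γ` of `γ` with `Γ(0) = e`: subdivide `[0, 1]` so that each piece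
maps into one standard chart (Lebesgue number), lift piecewise by the chart sections, rescaled to agree at the
division points. [cite: HatcherAT2002, §1.3 Prop. 1.30 (proof of path lifting)] -/
theorem exists_path_lift_mk (γ : C(I, ℙ ℂ (Fin (n + 1) → ℂ))) (e : Fin (n + 1) → ℂ) (he : e ≠ 0)
    (h0 : γ 0 = Projectivization.mk ℂ e he) :
    ∃ Γ : C(I, Fin (n + 1) → ℂ), ∃ hΓ : ∀ t, Γ t ≠ 0,
      (∀ t, Projectivization.mk ℂ (Γ t) (hΓ t) = γ t) ∧ Γ 0 = e := by
  choose sec hσc hσ0 hsec using fun i : Fin (n + 1) => exists_continuousOn_section_stdChart (n := n) i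
  obtain ⟨t, t_0, t_mono, ⟨n_max, h_max⟩, t_sub⟩ :=
    exists_monotone_Icc_subset_open_cover_unitInterval
      (fun i ↦ (Projectivization.isOpen_stdChartSource i).preimage γ.continuous)
      fun s _ ↦ Set.mem_iUnion.2 (Projectivization.exists_rep_apply_ne_zero (γ s))
  suffices ∀ m, ∃ Γ : I → (Fin (n + 1) → ℂ), ContinuousOn Γ (Set.Icc 0 (t m)) ∧
      (∀ s ∈ Set.Icc 0 (t m), ∃ h : Γ s ≠ 0, Projectivization.mk ℂ (Γ s) h = γ s) ∧ Γ 0 = e by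
    obtain ⟨Γ, cont, lifts, Γ_0⟩ := this n_max
    have huniv : Set.Icc (0 : I) (t n_max) = Set.univ := by
      rw [h_max _ le_rfl]; exact Set.eq_univ_iff_forall.2 fun s => ⟨bot_le, le_top⟩
    rw [huniv] at cont lifts
    exact ⟨⟨Γ, continuousOn_univ.1 cont⟩, fun s => (lifts s (Set.mem_univ s)).1,
      fun s => (lifts s (Set.mem_univ s)).2, Γ_0⟩
  intro m
  induction m with
  | zero =>
    refine ⟨fun _ ↦ e, continuous_const.continuousOn, fun s hs ↦ ⟨he, ?_⟩, rfl⟩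
    rw [t_0, Set.Icc_self, Set.mem_singleton_iff] at hs
    rw [hs, h0]
  | succ m ih =>
    obtain ⟨Γ, cont, lifts, Γ_0⟩ := ih
    obtain ⟨i, hi⟩ := t_sub m
    have h0m : (0 : I) ≤ t m := t_0.symm.le.trans (t_mono m.zero_le)
    obtain ⟨hΓ0, hΓm⟩ := lifts (t m) ⟨h0m, le_rfl⟩
    have hγi : γ (t m) ∈ Projectivization.stdChartSource i := hi ⟨le_rfl, t_mono m.le_succ⟩
    -- the two lifts of `γ (t m)` differ by a unit scalar `a`
    have hmk : Projectivization.mk ℂ (Γ (t m)) hΓ0 = Projectivization.mk ℂ (sec i (γ (t m))) (hσ0 i _) := by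
      rw [hΓm, hsec i _ hγi]
    obtain ⟨a, ha⟩ := (Projectivization.mk_eq_mk_iff ℂ _ _ _ _).1 hmk
    refine ⟨fun s ↦ if s ≤ t m then Γ s else (a : ℂ) • sec i (γ s), ?_, fun s hs ↦ ?_, ?_⟩
    · refine ContinuousOn.if (fun s hs ↦ ?_) (cont.mono fun s h ↦ ?_) ?_
      · cases frontier_Iic_subset _ hs.2
        rw [← ha, Units.smul_def]
      · rw [closure_le_eq continuous_id' continuous_const] at h; exact ⟨h.1.1, h.2⟩
      · have hsub : Set.Icc 0 (t (m + 1)) ∩ closure {s | ¬s ≤ t m} ⊆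
            γ ⁻¹' Projectivization.stdChartSource i := by
          simp_rw [not_le]; intro s h
          exact hi ⟨closure_lt_subset_le continuous_const continuous_subtype_val h.2, h.1.2⟩
        exact ((hσc i).comp γ.continuous.continuousOn fun s hs => hsub hs).const_smul (a : ℂ)
    · dsimp only
      by_cases h : s ≤ t m
      · rw [if_pos h]; exact lifts s ⟨hs.1, h⟩
      · rw [if_neg h]
        have hsi : γ s ∈ Projectivization.stdChartSource i := hi ⟨le_of_not_ge h, hs.2⟩
        exact ⟨smul_ne_zero a.ne_zero (hσ0 i _),
          ((Projectivization.mk_eq_mk_iff ℂ _ _ _ (hσ0 i _)).2 ⟨a, Units.smul_def a _⟩).trans (hsec i _ hsi)⟩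
    · dsimp only
      rw [if_pos h0m, Γ_0]

/-- **Loops of `T ⊆ ℙⁿ(ℂ)` lift to loops of any saturated `C ⊇ [·]⁻¹ T` in `ℂ^{n+1} ∖ 0`, up to homotopy**: for a
loop `γ` of `T` at `[e]` there are a loop `Γ` of `C` at `e` and a loop `γ₁ ≃ γ` of `T` which is pointwise
`[Γ]` (namely `γ₁ = γ · const`: lift `γ` by `exists_path_lift_mk`, ending at `a e`, `a ∈ ℂˣ`, and return to `e`
inside the fibre `ℂˣ e`, which is path connected and over which `[·]` is constant).
[cite: HatcherAT2002, §1.3 Prop. 1.30; §1.1 (reparametrisation `γ · const ≃ γ`)] -/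
theorem exists_loop_lift_of_saturated {T : Set (ℙ ℂ (Fin (n + 1) → ℂ))} {C : Set (Fin (n + 1) → ℂ)}
    (hC : ∀ (v : Fin (n + 1) → ℂ) (hv : v ≠ 0), Projectivization.mk ℂ v hv ∈ T → v ∈ C)
    {e : Fin (n + 1) → ℂ} (he : e ≠ 0) (heT : Projectivization.mk ℂ e he ∈ T)
    (γ : Path (⟨Projectivization.mk ℂ e he, heT⟩ : T) ⟨Projectivization.mk ℂ e he, heT⟩) :
    ∃ Γ : Path (⟨e, hC e he heT⟩ : C) ⟨e, hC e he heT⟩,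
      ∃ γ₁ : Path (⟨Projectivization.mk ℂ e he, heT⟩ : T) ⟨Projectivization.mk ℂ e he, heT⟩,
        (∀ t, ∃ h : (Γ t : Fin (n + 1) → ℂ) ≠ 0,
            ((γ₁ t : T) : ℙ ℂ (Fin (n + 1) → ℂ)) = Projectivization.mk ℂ (Γ t : Fin (n + 1) → ℂ) h) ∧
          Path.Homotopic.Quotient.mk γ = Path.Homotopic.Quotient.mk γ₁ := by
  -- lift the path
  let γc : C(I, ℙ ℂ (Fin (n + 1) → ℂ)) := ⟨fun t => ((γ t : T) : ℙ ℂ (Fin (n + 1) → ℂ)),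
    continuous_subtype_val.comp γ.continuous⟩
  obtain ⟨Γ₀, hΓ₀ne, hΓ₀mk, hΓ₀0⟩ := exists_path_lift_mk γc e he (by
    change ((γ 0 : T) : ℙ ℂ (Fin (n + 1) → ℂ)) = _; rw [γ.source])
  have hΓ₀T : ∀ t, Projectivization.mk ℂ (Γ₀ t) (hΓ₀ne t) ∈ T := fun t => by rw [hΓ₀mk]; exact (γ t).2
  -- the end point is `a • e`
  have hend : Projectivization.mk ℂ (Γ₀ 1) (hΓ₀ne 1) = Projectivization.mk ℂ e he := by
    rw [hΓ₀mk]; change ((γ 1 : T) : ℙ ℂ (Fin (n + 1) → ℂ)) = _; rw [γ.target]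
  obtain ⟨a, ha⟩ := (Projectivization.mk_eq_mk_iff ℂ _ _ _ _).1 hend
  -- an arc in `ℂ ∖ 0` from `a` to `1`
  have hpc : IsPathConnected ({(0 : ℂ)}ᶜ : Set ℂ) :=
    isPathConnected_compl_singleton_of_one_lt_rank (by rw [Complex.rank_real_complex]; norm_num) 0
  have hj : JoinedIn ({(0 : ℂ)}ᶜ : Set ℂ) (a : ℂ) 1 := hpc.joinedIn _ a.ne_zero _ one_ne_zero
  let ρ : Path (a : ℂ) 1 := hj.somePath
  have hρ : ∀ s, ρ s ≠ 0 := fun s => hj.somePath_mem s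
  have hfib : ∀ s, Projectivization.mk ℂ (ρ s • e) (smul_ne_zero (hρ s) he) = Projectivization.mk ℂ e he :=
    fun s => (Projectivization.mk_eq_mk_iff ℂ _ _ _ _).2 ⟨Units.mk0 (ρ s) (hρ s), by rw [Units.smul_mk0]⟩
  -- the two pieces of the loop in `C`
  let ΓA : Path (⟨e, hC e he heT⟩ : C) ⟨Γ₀ 1, hC _ (hΓ₀ne 1) (hΓ₀T 1)⟩ :=
    { toFun := fun s => ⟨Γ₀ s, hC _ (hΓ₀ne s) (hΓ₀T s)⟩
      continuous_toFun := Γ₀.continuous.subtype_mk _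
      source' := Subtype.ext hΓ₀0
      target' := rfl }
  let ΓB : Path (⟨Γ₀ 1, hC _ (hΓ₀ne 1) (hΓ₀T 1)⟩ : C) ⟨e, hC e he heT⟩ :=
    { toFun := fun s => ⟨ρ s • e, hC _ (smul_ne_zero (hρ s) he) (by rw [hfib]; exact heT)⟩
      continuous_toFun := (ρ.continuous.smul continuous_const).subtype_mk _
      source' := Subtype.ext (by change ρ 0 • e = Γ₀ 1; rw [ρ.source, ← ha, Units.smul_def])
      target' := Subtype.ext (by change ρ 1 • e = e; rw [ρ.target, one_smul]) }
  refine ⟨ΓA.trans ΓB, γ.trans (Path.refl _), fun s => ?_, ?_⟩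
  · rw [Path.trans_apply, Path.trans_apply]
    split_ifs with h
    · exact ⟨hΓ₀ne _, (hΓ₀mk _).symm⟩
    · exact ⟨smul_ne_zero (hρ _) he, (hfib _).symm⟩
  · rw [Path.Homotopic.Quotient.mk_trans, Path.Homotopic.Quotient.mk_refl, Path.Homotopic.Quotient.trans_refl]

/-! ### §2 Transport of loop classes -/

/-- Transport of an equality of loop classes along a continuous map: if `⟦p⟧ = ⟦q⟧` in `Y` and the loop `a` of
`X` is pointwise `Ψ ∘ p`, then `⟦a⟧ = ⟦b⟧` for a loop `b` that is pointwise `Ψ ∘ q`.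
[cite: HatcherAT2002, §1.1 (induced homomorphisms)] -/
theorem exists_loop_mk_eq_of_comp {X Y : Type*} [TopologicalSpace X] [TopologicalSpace Y] (Ψ : C(Y, X)) {y : Y}
    {p q : Path y y} (hpq : Path.Homotopic.Quotient.mk p = Path.Homotopic.Quotient.mk q) {x : X} (a : Path x x)
    (ha : ∀ t, a t = Ψ (p t)) :
    ∃ b : Path x x, (∀ t, b t = Ψ (q t)) ∧ Path.Homotopic.Quotient.mk a = Path.Homotopic.Quotient.mk b := by
  have hx : x = Ψ y := by rw [← p.source, ← ha 0, a.source]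
  have ha' : a = (p.map Ψ.continuous).cast hx hx := by
    ext t; rw [Path.cast_coe, Path.map_coe, Function.comp_apply, ha]
  refine ⟨(q.map Ψ.continuous).cast hx hx, fun t => by rw [Path.cast_coe, Path.map_coe, Function.comp_apply], ?_⟩
  rw [ha', Path.Homotopic.Quotient.mk_cast, Path.Homotopic.Quotient.mk_cast, Path.Homotopic.Quotient.mk_map,
    Path.Homotopic.Quotient.mk_map, hpq]

/-! ### §3 The discharge -/

/-- **Zariski's theorem (Voisin II, Thm. 3.22) — DISCHARGE of the named fact `zariski_pi1_lineCompl_surjective`.**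
For a hypersurface `𝒴 = V(F) ⊂ ℙʳ(ℂ)` (`F` homogeneous of degree `d ≥ 1`), `U = ℙʳ − 𝒴`, and a projective line
`Δ = ℙ(P)` through `x₀ ∈ U` meeting `𝒴` transversally in its smooth locus (at every zero `w ∈ P ∖ 0` of `F`,
`dF(w)` does not vanish on `P`), every loop of `U` at `x₀` is homotopic to a loop contained in `Δ`.
Proof: lift the loop to the cone `ℂ^{r+1} ∖ V(F)` over `U` (§1), apply the affine Zariski theorem along the
affine line `e + ℂ v ⊂ P` (`pencilDiscr F (e, v) ≠ 0` by `eval_pencilDiscr_ne_zero_of_transversal`), and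
project back to `U`.
[cite: VoisinHodgeII2003, §3.2.2 Thm. 3.22] [cite: Dimca1992, Ch. 4 §3 Prop. (3.1)] -/
theorem zariski_pi1_lineCompl_surjective_holds : zariski_pi1_lineCompl_surjective := by
  intro r d F hF hd P hP htrans x₀ hx₀ hx₀P γ
  classical
  -- `F` is homogeneous of degree `totalDegree F = d` (needed for `mem_projZeroLocus_mk_iff`)
  have hFne : F ≠ 0 := by
    intro hF0
    apply hx₀
    change ∀ G ∈ ({F} : Set (MvPolynomial (Fin (r + 1)) ℂ)), MvPolynomial.eval x₀.rep G = 0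
    intro G hG; rw [Set.mem_singleton_iff.1 hG, hF0, map_zero]
  have hFt : F.IsHomogeneous F.totalDegree := by rwa [hF.totalDegree hFne]
  have hS : ∀ G ∈ ({F} : Set (MvPolynomial (Fin (r + 1)) ℂ)), G.IsHomogeneous G.totalDegree := fun G hG => by
    rw [Set.mem_singleton_iff.1 hG]; exact hFt
  have hmemU : ∀ (v : Fin (r + 1) → ℂ) (hv : v ≠ 0),
      Projectivization.mk ℂ v hv ∈ (Projectivization.projZeroLocus {F})ᶜ ↔ MvPolynomial.eval v F ≠ 0 := by
    intro v hv
    rw [Set.mem_compl_iff, Projectivization.mem_projZeroLocus_mk_iff hS v hv]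
    simp
  -- ### a vector `b` over `x₀`; we may assume `x₀ = [b]`
  obtain ⟨b, hb0, rfl⟩ : ∃ (b : Fin (r + 1) → ℂ) (hb : b ≠ 0), Projectivization.mk ℂ b hb = x₀ :=
    ⟨x₀.rep, x₀.rep_nonzero, x₀.mk_rep⟩
  have hFb : MvPolynomial.eval b F ≠ 0 := (hmemU b hb0).1 hx₀
  have hbP : b ∈ P := hx₀P (by rw [Projectivization.submodule_mk]; exact Submodule.mem_span_singleton_self b)
  -- ### a good direction in `P` and the pencil discriminant on the cone
  obtain ⟨v, hvP, hFv, hind, hrepr⟩ := exists_direction_of_transversal hF hP hbP hb0 hFb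
  have hQ : MvPolynomial.eval (Sum.elim b v) (pencilDiscr F) ≠ 0 := by
    refine eval_pencilDiscr_ne_zero_of_transversal hF hFb hFv fun c hc => ?_
    obtain ⟨p, hpP, hp⟩ := htrans (b + c • v) (P.add_mem hbP (P.smul_mem c hvP)) (hind c) hc
    obtain ⟨α, β, hαβ⟩ := hrepr p hpP
    exact ⟨α, β, by rw [hαβ]; exact hp⟩
  have hbU : b ∈ affineHypersurfaceComplement ![F] := mem_affineHypersurfaceComplement_of_pencilDiscr hQ
  -- ### the cone `ℂ^{r+1} ∖ V(F)` over `U` and the projection `v ↦ [v]`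
  have hC : ∀ (w : Fin (r + 1) → ℂ) (hw : w ≠ 0),
      Projectivization.mk ℂ w hw ∈ (Projectivization.projZeroLocus ({F} : Set (MvPolynomial (Fin (r + 1)) ℂ)))ᶜ →
        w ∈ affineHypersurfaceComplement ![F] := by
    intro w hw hwU
    rw [mem_affineHypersurfaceComplement_iff]
    intro j; fin_cases j
    exact (hmemU w hw).1 hwU
  have hF0 : MvPolynomial.eval (0 : Fin (r + 1) → ℂ) F = 0 := by
    have h := Projectivization.eval_smul_of_isHomogeneous hF (0 : ℂ) b
    rwa [zero_smul, zero_pow (by omega : d ≠ 0), zero_mul] at h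
  have hne : ∀ w : ↥(affineHypersurfaceComplement ![F]), (w : Fin (r + 1) → ℂ) ≠ 0 := fun w hw0 =>
    w.2 0 (by rw [hw0]; simpa using hF0)
  let qU : C(↥(affineHypersurfaceComplement ![F]),
      ↥(Projectivization.projZeroLocus ({F} : Set (MvPolynomial (Fin (r + 1)) ℂ)))ᶜ) :=
    ⟨fun w => ⟨Projectivization.mk ℂ (w : Fin (r + 1) → ℂ) (hne w), (hmemU _ (hne w)).2 (w.2 0)⟩,
      (Projectivization.continuous_mk.comp (continuous_subtype_val.subtype_mk fun w => hne w)).subtype_mk _⟩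
  -- ### lift the loop to the cone
  obtain ⟨Γ, γ₁, hγ₁, hγγ₁⟩ := exists_loop_lift_of_saturated hC hb0 hx₀ γ
  have hγ₁Γ : γ₁ = Γ.map qU.continuous := by
    ext t : 2
    obtain ⟨h, ht⟩ := hγ₁ t
    exact Subtype.ext ht
  rw [hγ₁Γ] at hγγ₁
  -- ### affine Zariski along `b + ℂ v`, and projection back to `U`
  obtain ⟨ω, hω⟩ := exists_loop_in_line_of_pencilDiscr hbU hQ Γ
  obtain ⟨γ', hγ'val, hγ'⟩ := exists_loop_mk_eq_of_comp qU hω (a := Γ.map qU.continuous) (fun t => rfl)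
  refine ⟨γ', fun t => ?_, Path.Homotopic.Quotient.eq.1 (hγγ₁.trans hγ').symm⟩
  -- the loop `γ'` lies in `ℙ(P)`: its points are `[b + ω(t) • ((b + v) - b)]`
  rw [hγ'val t, Path.cast_coe, Path.map_coe, Function.comp_apply]
  change (Projectivization.mk ℂ (LineSlice.linePt b (b + v) (ω t : ℂ)) _).submodule ≤ P
  rw [Projectivization.submodule_mk, Submodule.span_singleton_le_iff_mem, LineSlice.linePt, add_sub_cancel_left]
  exact P.add_mem hbP (P.smul_mem _ hvP)

end Zariski

end Literature.AlgebraicGeometry.HodgeTheory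

end
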